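import Summits.QuantumFields.YangMills.Theorems.LuscherReductionTwistedTraceScalingToronLinkSpectrum
import Summits.QuantumFields.YangMills.Theorems.LuscherReductionTwistedTraceScalingToronZeroMode
import Summits.QuantumFields.YangMills.Theorems.LuscherReductionTwistedTraceScalingToronAdaptedFrame
import HarnessLib

/-!
# The SLOW (zero-momentum) block at a constant abelian background: the nine explicit constant modes, their span `slowModes θ` (invariant under `D_θ†D_θ`),
# and the Born–Oppenheimer split of the zero-point sum — `Σ_slow = 4·zeroModeZPE κ (2θ)` (one-site), `Σ_fast = 2Z(0) + 4·restZPE (2θ)` — in EVERY adapted frame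
# (crux `TwistedTraceScaling` stmt-QuantumFields-20203 S-BASE, COARSE lanes; design `pub/ym-fleet/ym-luscher-20007-p1/COARSE-DESIGN.md` §14)

The nine slow vectors at `V_θ`: three neutral direction indicators `neutralConst k` (zero modes: tangent to the flat valley) and the six zero-momentum charged
plane waves of `…ToronLinkSpectrum.linkFrame` (values `pwValue (2θ) (0,s) = (0, ‖q̂₀‖², ‖q̂₀‖²)`, twice).  They are orthonormal eigenvectors, so their span is
invariant and `…ToronAdaptedFrame.exists_isDiag_adapted` gives eigenframes of `‖D_{V_θ}·‖²` adapted to slow ⊕ fast; frame independence INSIDE the slow block pins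
the slow zero-point sum to the ONE-SITE value `4·modeZPE(κ·Σ_k(2−2cos 2θ_k))`, and C3a pins the fast remainder.  This is the spectral input of the windowed harmonic step
(`Literature.…GaussianTransferKernelWindow`) with window = fast modes.
* `neutralConst`, `slowVec`, `slowValue`, `orthonormal_slowVec`, `inner_covCurl_slowVec`; `slowModes`, ★ `covHessian_mem_slowModes` (invariance), `slowBasis`,
  `isDiag_slowBasis`, ★ `sum_modeZPE_slowValue = 4·zeroModeZPE κ (2θ)`;
* ★★ `exists_isDiag_adapted_slowModes`; ★★★ `sum_modeZPE_slow_of_adapted`, ★★★ `sum_modeZPE_fast_of_adapted`.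

HONEST FRAMING: fixed-lattice linear algebra; femto rung R2b1 (brick for a stub of a child of a CONDITIONAL route); not a gap, not Clay.
-/

set_option autoImplicit false

noncomputable section

open Finset Module
open scoped BigOperators InnerProductSpace RealInnerProductSpace
open Literature.MathematicalPhysics.QuantumFieldTheory
open Literature.MathematicalPhysics.QuantumLattice

namespace Summit.QuantumFields.YangMills.Theorems.FemtoTransferGap.TwoLattice.Toron

open Summit.QuantumFields.YangMills.Theorems.FemtoTransferGap
open Summit.QuantumFields.YangMills.Theorems.FemtoTransferGap.TwoLattice
open Summit.QuantumFields.YangMills.Theorems.FemtoTransferGap.TwoLattice.Cov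
open Summit.QuantumFields.YangMills.Theorems.FemtoTransferGap.TwoLattice.Stiff

variable (L : ℕ) [NeZero L]

/-! ## §1 The nine slow vectors -/

/-- The normalised direction indicator on scalar link fields: `x ↦ [i = k]·(√L³)⁻¹`. [folklore] -/
def dirIndicator (k : Fin 3) : EuclideanSpace ℝ (Edge 3 L) := WithLp.toLp 2 fun e : Edge 3 L => if e.2 = k then pwc L else 0

/-- The neutral constant mode of direction `k` (normalised): `(x,i;a) ↦ [i = k][a = 0]·(√L³)⁻¹`. [cite: Luscher1983, §3] -/
def neutralConst (k : Fin 3) : LinkSpace L := neutralEmbed L (dirIndicator L k)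

omit [NeZero L] in
/-- The direction indicators are killed by the plain curl. [folklore] -/
theorem reCurl_dirIndicator (k : Fin 3) : reCurl L (dirIndicator L k) = 0 := by
  ext ⟨x, kl⟩
  rw [reCurl_apply]
  simp [dirIndicator]

omit [NeZero L] in
/-- ★ The neutral constant modes are zero modes of `D_{V_θ}`. [cite: Luscher1983, §3] -/
theorem covCurl_abelianCfg_neutralConst (θ : Fin 3 → ℝ) (k : Fin 3) : covCurl (abelianCfg L θ) (neutralConst L k) = 0 := by
  ext ⟨p, a⟩
  rw [neutralConst, covCurl_abelianCfg_neutralEmbed, reCurl_dirIndicator]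
  fin_cases a <;> simp

/-- The direction indicators are orthonormal in `ℝ^{Edge}`. [folklore] -/
theorem inner_dirIndicator (k k' : Fin 3) : ⟪dirIndicator L k, dirIndicator L k'⟫ = if k = k' then 1 else 0 := by
  have hc : pwc L * pwc L * (Fintype.card (Site 3 L) : ℝ) = 1 := by
    have h := conj_pwc_mul_pwc_mul L
    rw [Complex.conj_ofReal] at h
    have hcard : (Fintype.card (Site 3 L) : ℝ) = (L : ℝ) ^ 3 := by
      rw [Fintype.card_pi, Fin.prod_const, ZMod.card]; push_cast; ring
    rw [hcard]
    exact_mod_cast h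
  rw [PiLp.inner_apply, Fintype.sum_prod_type]
  simp only [dirIndicator, RCLike.inner_apply, conj_trivial]
  by_cases hkk : k = k'
  · subst hkk
    rw [if_pos rfl]
    have : ∀ x : Site 3 L, ∑ i : Fin 3, (if ((x, i) : Edge 3 L).2 = k then pwc L else 0) * (if ((x, i) : Edge 3 L).2 = k then pwc L else 0) =
        pwc L * pwc L := fun x => by
      rw [Fintype.sum_eq_single k (fun i hi => by simp [hi])]
      simp
    simp_rw [this]
    rw [sum_const, card_univ, nsmul_eq_mul, mul_comm, hc]
  · rw [if_neg hkk]
    refine sum_eq_zero fun x _ => sum_eq_zero fun i _ => ?_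
    by_cases h1 : i = k
    · subst h1; simp [hkk]
    · simp [h1]

/-- Index of the slow block: 3 neutral + (3 + 3) charged. [folklore] -/
abbrev SIdx : Type := Fin 3 ⊕ (Fin 3 ⊕ Fin 3)

/-- The nine slow vectors at `V_θ`. [cite: Luscher1983, §3] -/
def slowVec (θ : Fin 3 → ℝ) : SIdx → LinkSpace L
  | Sum.inl k => neutralConst L k
  | Sum.inr (Sum.inl s) => linkFrameVec L θ (Sum.inr (Sum.inl ((0 : Site 3 L), s)))
  | Sum.inr (Sum.inr s) => linkFrameVec L θ (Sum.inr (Sum.inr ((0 : Site 3 L), s)))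

/-- Their values under `‖D_{V_θ}·‖²`: `0` (neutral), `pwValue (2θ) (0,s)` (charged, twice). [cite: Luscher1983, §3] -/
def slowValue (θ : Fin 3 → ℝ) : SIdx → ℝ
  | Sum.inl _ => 0
  | Sum.inr (Sum.inl s) => pwValue L (fun k => 2 * θ k) (0, s)
  | Sum.inr (Sum.inr s) => pwValue L (fun k => 2 * θ k) (0, s)

/-- The embedding of the charged slow indices into the index set of `linkFrame`. [folklore] -/
def slowToLIdx : Fin 3 ⊕ Fin 3 → LIdx L
  | Sum.inl s => Sum.inr (Sum.inl ((0 : Site 3 L), s))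
  | Sum.inr s => Sum.inr (Sum.inr ((0 : Site 3 L), s))

/-- It is injective. [folklore] -/
theorem slowToLIdx_injective : Function.Injective (slowToLIdx L) := by
  rintro (s | s) (s' | s') h <;> simp_all [slowToLIdx]

/-- The charged slow vectors are `linkFrame` vectors; their values are `linkValue`. [folklore] -/
theorem slowVec_inr (θ : Fin 3 → ℝ) (x : Fin 3 ⊕ Fin 3) :
    slowVec L θ (Sum.inr x) = linkFrame L θ (slowToLIdx L x) ∧ slowValue L θ (Sum.inr x) = linkValue L θ (slowToLIdx L x) := by
  rcases x with s | s
  · exact ⟨by rw [linkFrame_apply]; rfl, rfl⟩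
  · exact ⟨by rw [linkFrame_apply]; rfl, rfl⟩

/-- ★ The nine slow vectors are orthonormal. [folklore] -/
theorem orthonormal_slowVec (θ : Fin 3 → ℝ) : Orthonormal ℝ (slowVec L θ) := by
  classical
  have hlf := orthonormal_iff_ite.mp (linkFrame L θ).orthonormal
  rw [orthonormal_iff_ite]
  rintro (k | x) (k' | x')
  · simp only [slowVec, neutralConst, inner_neutralEmbed, inner_dirIndicator, Sum.inl.injEq]
  · rcases x' with s | s <;>
      simp only [slowVec, neutralConst, linkFrameVec, inner_neutralEmbed_chargedEmbed, reduceCtorEq, if_false]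
  · rcases x with s | s <;>
      simp only [slowVec, neutralConst, linkFrameVec, inner_chargedEmbed_neutralEmbed, reduceCtorEq, if_false]
  · rw [(slowVec_inr L θ x).1, (slowVec_inr L θ x').1, hlf]
    by_cases h : x = x'
    · subst h; simp
    · rw [if_neg (fun hh => h (slowToLIdx_injective L hh)), if_neg (fun hh => h (Sum.inr_injective hh))]

/-- ★ The nine slow vectors diagonalise the form pairwise, with the values `slowValue`. [cite: Luscher1983, §3] -/
theorem inner_covCurl_slowVec (θ : Fin 3 → ℝ) (m m' : SIdx) :
    ⟪covCurl (abelianCfg L θ) (slowVec L θ m), covCurl (abelianCfg L θ) (slowVec L θ m')⟫ = if m = m' then slowValue L θ m else 0 := by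
  classical
  rcases m with k | x
  · have h0 : covCurl (abelianCfg L θ) (slowVec L θ (Sum.inl k)) = 0 := covCurl_abelianCfg_neutralConst L θ k
    rw [h0, inner_zero_left]
    split_ifs <;> rfl
  · rcases m' with k' | x'
    · have h0 : covCurl (abelianCfg L θ) (slowVec L θ (Sum.inl k')) = 0 := covCurl_abelianCfg_neutralConst L θ k'
      rw [h0, inner_zero_right, if_neg (by simp)]
    · rw [(slowVec_inr L θ x).1, (slowVec_inr L θ x').1, isDiag_linkFrame L θ]
      by_cases h : x = x'
      · subst h
        rw [if_pos rfl, if_pos rfl, (slowVec_inr L θ x).2]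
        simp
      · rw [if_neg (fun hh => h (slowToLIdx_injective L hh)), if_neg (fun hh => h (Sum.inr_injective hh))]

/-! ## §2 The slow subspace, its invariance and its explicit orthonormal basis -/

/-- **The slow subspace** at `V_θ`: the span of the nine slow vectors (the constant modes). [cite: Luscher1983, §3] -/
abbrev slowModes (θ : Fin 3 → ℝ) : Submodule ℝ (LinkSpace L) := Submodule.span ℝ (Set.range (slowVec L θ))

/-- Each slow vector is an eigenvector of the covariant Hessian. [cite: Luscher1983, §3] -/
theorem covHessian_slowVec (θ : Fin 3 → ℝ) (m : SIdx) :
    (covCurl (abelianCfg L θ)).adjoint (covCurl (abelianCfg L θ) (slowVec L θ m)) = slowValue L θ m • slowVec L θ m := by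
  classical
  rcases m with k | x
  · have h0 : covCurl (abelianCfg L θ) (slowVec L θ (Sum.inl k)) = 0 := covCurl_abelianCfg_neutralConst L θ k
    rw [h0, map_zero]
    simp [slowValue]
  · rw [(slowVec_inr L θ x).1, (slowVec_inr L θ x).2]
    have h := (isDiag_linkFrame L θ).apply_eq_smul (T := (covCurl (abelianCfg L θ)).adjoint ∘ₗ covCurl (abelianCfg L θ))
      (fun u v => by rw [LinearMap.comp_apply, LinearMap.adjoint_inner_right]) (slowToLIdx L x)
    rwa [LinearMap.comp_apply] at h

/-- ★ **The slow subspace is invariant** under `D_θ†D_θ`. [cite: Luscher1983, §3] -/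
theorem covHessian_mem_slowModes (θ : Fin 3 → ℝ) {v : LinkSpace L} (hv : v ∈ slowModes L θ) :
    (covCurl (abelianCfg L θ)).adjoint (covCurl (abelianCfg L θ) v) ∈ slowModes L θ := by
  have h : ((covCurl (abelianCfg L θ)).adjoint ∘ₗ covCurl (abelianCfg L θ)) v ∈ (slowModes L θ).map
      ((covCurl (abelianCfg L θ)).adjoint ∘ₗ covCurl (abelianCfg L θ)) := Submodule.mem_map_of_mem hv
  rw [Submodule.map_span] at h
  refine Submodule.span_le.mpr ?_ h
  rintro _ ⟨_, ⟨m, rfl⟩, rfl⟩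
  rw [LinearMap.comp_apply, covHessian_slowVec]
  exact Submodule.smul_mem _ _ (Submodule.subset_span ⟨m, rfl⟩)

/-- The explicit orthonormal basis of the slow subspace. [folklore] -/
def slowBasis (θ : Fin 3 → ℝ) : OrthonormalBasis SIdx ℝ (slowModes L θ) :=
  (Basis.span (orthonormal_slowVec L θ).linearIndependent).toOrthonormalBasis (by
    classical
    rw [orthonormal_iff_ite]
    intro m m'
    rw [Submodule.coe_inner, Basis.coe_span_apply, Basis.coe_span_apply, orthonormal_iff_ite.mp (orthonormal_slowVec L θ)])

/-- Its vectors. [folklore] -/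
theorem coe_slowBasis (θ : Fin 3 → ℝ) (m : SIdx) : (slowBasis L θ m : LinkSpace L) = slowVec L θ m := by
  unfold slowBasis
  rw [Basis.coe_toOrthonormalBasis, Basis.coe_span_apply]

/-- The explicit basis diagonalises the restricted form with values `slowValue`. [folklore] -/
theorem isDiag_slowBasis (θ : Fin 3 → ℝ) :
    Frame.IsDiag (covCurl (abelianCfg L θ) ∘ₗ (slowModes L θ).subtype) (slowBasis L θ) (slowValue L θ) := fun m m' => by
  classical
  rw [LinearMap.comp_apply, LinearMap.comp_apply, Submodule.subtype_apply, Submodule.subtype_apply, coe_slowBasis, coe_slowBasis,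
    inner_covCurl_slowVec]
  split_ifs <;> rfl

/-- ★ **The slow zero-point sum is the ONE-SITE value**: `Σ_m modeZPE(κ·slowValue m) = 4·zeroModeZPE κ (2θ)`. [cite: Luscher1983, §3] -/
theorem sum_modeZPE_slowValue (θ : Fin 3 → ℝ) (κ : ℝ) : ∑ m, modeZPE (κ * slowValue L θ m) = 4 * zeroModeZPE κ (fun k => 2 * θ k) := by
  have hq : ‖qhat L (fun k => 2 * θ k) 0‖ ^ 2 = ∑ k, (2 - 2 * Real.cos (2 * θ k)) := by
    rw [norm_qhat_sq]
    exact sum_congr rfl fun k _ => by simp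
  have h0 : pwValue L (fun k => 2 * θ k) (0, 0) = 0 := by simp [pwValue]
  have h1 : pwValue L (fun k => 2 * θ k) (0, 1) = ‖qhat L (fun k => 2 * θ k) 0‖ ^ 2 := by simp [pwValue]
  have h2 : pwValue L (fun k => 2 * θ k) (0, 2) = ‖qhat L (fun k => 2 * θ k) 0‖ ^ 2 := by simp [pwValue]
  rw [Fintype.sum_sum_type, Fintype.sum_sum_type]
  simp only [slowValue, mul_zero, modeZPE_zero, sum_const_zero, zero_add, Fin.sum_univ_three, h0, h1, h2, hq, zeroModeZPE]
  ring

/-! ## §3 Adapted frames and the Born–Oppenheimer split of the zero-point sum -/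

/-- ★★ **Adapted eigenframes exist**: an orthonormal frame diagonalising `‖D_{V_θ}·‖²` with every vector in `slowModes θ` or in its orthogonal complement.
[cite: HornJohnson2013, Thm 2.5.6] -/
theorem exists_isDiag_adapted_slowModes (θ : Fin 3 → ℝ) :
    ∃ (n : ℕ) (e : OrthonormalBasis (Fin n) ℝ (LinkSpace L)),
      Frame.IsDiag (covCurl (abelianCfg L θ)) e (fun i => ‖covCurl (abelianCfg L θ) (e i)‖ ^ 2) ∧ ∀ i, e i ∈ slowModes L θ ∨ e i ∈ (slowModes L θ)ᗮ :=
  Frame.exists_isDiag_adapted (covCurl (abelianCfg L θ)) (slowModes L θ) fun _ hv => covHessian_mem_slowModes L θ hv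

section Adapted

open scoped Classical

/-- The slow vectors of a frame adapted to `slowModes θ`, as elements of the subspace. [folklore] -/
def adaptedSlowVec (θ : Fin 3 → ℝ) {n : ℕ} (e : OrthonormalBasis (Fin n) ℝ (LinkSpace L)) (i : {i : Fin n // e i ∈ slowModes L θ}) :
    slowModes L θ := ⟨e i.1, i.2⟩

/-- They are orthonormal. [folklore] -/
theorem orthonormal_adaptedSlowVec (θ : Fin 3 → ℝ) {n : ℕ} (e : OrthonormalBasis (Fin n) ℝ (LinkSpace L)) :
    Orthonormal ℝ (adaptedSlowVec L θ e) := by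
  rw [orthonormal_iff_ite]
  intro i j
  rw [Submodule.coe_inner, adaptedSlowVec, adaptedSlowVec, orthonormal_iff_ite.mp e.orthonormal]
  by_cases hij : i = j
  · subst hij; simp
  · rw [if_neg (fun h => hij (Subtype.ext h)), if_neg hij]

/-- They span the slow subspace (from `Frame.mem_span_of_adapted` in the ambient space). [folklore] -/
theorem span_adaptedSlowVec (θ : Fin 3 → ℝ) {n : ℕ} (e : OrthonormalBasis (Fin n) ℝ (LinkSpace L))
    (hadapt : ∀ i, e i ∈ slowModes L θ ∨ e i ∈ (slowModes L θ)ᗮ) :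
    ⊤ ≤ Submodule.span ℝ (Set.range (adaptedSlowVec L θ e)) := by
  rintro s -
  have hs : (s : LinkSpace L) ∈ Submodule.span ℝ (Set.range fun i : {i : Fin n // e i ∈ slowModes L θ} => e (i : Fin n)) :=
    Frame.mem_span_of_adapted hadapt s.2
  have himg : (Set.range fun i : {i : Fin n // e i ∈ slowModes L θ} => e (i : Fin n)) =
      (slowModes L θ).subtype '' Set.range (adaptedSlowVec L θ e) := by
    rw [← Set.range_comp]; rfl
  rw [himg, ← Submodule.map_span] at hs
  obtain ⟨t, ht, hts⟩ := Submodule.mem_map.mp hs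
  have : t = s := Subtype.ext hts
  rw [← this]; exact ht

/-- The slow vectors of an adapted frame, as an orthonormal basis of the slow subspace. [folklore] -/
def adaptedSlowBasis (θ : Fin 3 → ℝ) {n : ℕ} (e : OrthonormalBasis (Fin n) ℝ (LinkSpace L))
    (hadapt : ∀ i, e i ∈ slowModes L θ ∨ e i ∈ (slowModes L θ)ᗮ) :
    OrthonormalBasis {i : Fin n // e i ∈ slowModes L θ} ℝ (slowModes L θ) :=
  OrthonormalBasis.mk (orthonormal_adaptedSlowVec L θ e) (span_adaptedSlowVec L θ e hadapt)

/-- Its vectors. [folklore] -/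
theorem coe_adaptedSlowBasis (θ : Fin 3 → ℝ) {n : ℕ} (e : OrthonormalBasis (Fin n) ℝ (LinkSpace L))
    (hadapt : ∀ i, e i ∈ slowModes L θ ∨ e i ∈ (slowModes L θ)ᗮ) (i : {i : Fin n // e i ∈ slowModes L θ}) :
    (adaptedSlowBasis L θ e hadapt i : LinkSpace L) = e (i : Fin n) := by
  rw [adaptedSlowBasis, OrthonormalBasis.coe_mk]; rfl

/-- ★★★ **BO SPLIT, SLOW PART**: in every adapted eigenframe of `‖D_{V_θ}·‖²`, the slow vectors' zero-point sum is the one-site value `4·zeroModeZPE κ (2θ)`.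
[cite: Luscher1983, §3] -/
theorem sum_modeZPE_slow_of_adapted (θ : Fin 3 → ℝ) {n : ℕ} {e : OrthonormalBasis (Fin n) ℝ (LinkSpace L)}
    (h : Frame.IsDiag (covCurl (abelianCfg L θ)) e (fun i => ‖covCurl (abelianCfg L θ) (e i)‖ ^ 2))
    (hadapt : ∀ i, e i ∈ slowModes L θ ∨ e i ∈ (slowModes L θ)ᗮ) (κ : ℝ) :
    ∑ i : {i : Fin n // e i ∈ slowModes L θ}, modeZPE (κ * ‖covCurl (abelianCfg L θ) (e (i : Fin n))‖ ^ 2) = 4 * zeroModeZPE κ (fun k => 2 * θ k) := by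
  classical
  have hf : Frame.IsDiag (covCurl (abelianCfg L θ) ∘ₗ (slowModes L θ).subtype) (adaptedSlowBasis L θ e hadapt)
      (fun i => ‖covCurl (abelianCfg L θ) (e (i : Fin n))‖ ^ 2) := fun i j => by
    rw [LinearMap.comp_apply, LinearMap.comp_apply, Submodule.subtype_apply, Submodule.subtype_apply, coe_adaptedSlowBasis, coe_adaptedSlowBasis,
      h (i : Fin n) (j : Fin n)]
    by_cases hij : i = j
    · subst hij; simp
    · rw [if_neg (fun hh => hij (Subtype.ext hh)), if_neg hij]
  rw [hf.sum_eq_sum (isDiag_slowBasis L θ) (fun y => modeZPE (κ * y)), sum_modeZPE_slowValue]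

/-- ★★★ **BO SPLIT, FAST PART**: in every adapted eigenframe the fast vectors' zero-point sum is `2·toronZPE L κ 0 0 + 4·restZPE L κ (2θ)`
(the vacuum neutral sum plus the even, gapped remainder of the charged toron sum). [cite: Luscher1983, §3] -/
theorem sum_modeZPE_fast_of_adapted (θ : Fin 3 → ℝ) {n : ℕ} {e : OrthonormalBasis (Fin n) ℝ (LinkSpace L)}
    (h : Frame.IsDiag (covCurl (abelianCfg L θ)) e (fun i => ‖covCurl (abelianCfg L θ) (e i)‖ ^ 2))
    (hadapt : ∀ i, e i ∈ slowModes L θ ∨ e i ∈ (slowModes L θ)ᗮ) (κ : ℝ) :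
    ∑ i : {i : Fin n // ¬ e i ∈ slowModes L θ}, modeZPE (κ * ‖covCurl (abelianCfg L θ) (e (i : Fin n))‖ ^ 2) =
      2 * toronZPE L κ 0 0 + 4 * restZPE L κ (fun k => 2 * θ k) := by
  classical
  have htot := sum_modeZPE_of_isDiag_covCurl_abelianCfg L θ h κ
  rw [← Fintype.sum_subtype_add_sum_subtype (fun i => e i ∈ slowModes L θ) (fun i => modeZPE (κ * ‖covCurl (abelianCfg L θ) (e i)‖ ^ 2)),
    sum_modeZPE_slow_of_adapted L θ h hadapt κ, toronZPE_eq_zeroModeZPE_add_restZPE L κ (fun k => 2 * θ k)] at htot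
  linarith

end Adapted

end Summit.QuantumFields.YangMills.Theorems.FemtoTransferGap.TwoLattice.Toron

end
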